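import Summits.QuantumFields.YangMills.Theorems.UnitScaleTiltProp7CombTrueStepSplit
import Summits.QuantumFields.YangMills.Theorems.UnitScaleTiltProp7CornerCombLoopDefects
import Summits.QuantumFields.YangMills.Theorems.UnitScaleTiltProp7CornerCombFlatGradTransfer
import HarnessLib

/-!
# `UnitScaleTiltProp7CornerCombCovGradTransfer` — F-6b-cov, part 2: THE COVARIANT GRADIENT TRANSFER OF PRINT's STRAIGHT STEP `L·Q₀` at a
curved background (the dressed twin of ✓`UnitScaleTiltProp7CornerCombFlatGradTransfer`; MASTER 6efb31c3 §1 row 6 «`L^{(4−d)∕2} + c₃L²p_j`»)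

«(O2) groundwork — not consumed by any displayed row before the freeze lifts» (★★OWNER ym3-torus-plan g29 RULINGS №19 (O2), №20 (2),
№22 (c); «(II) GO» of record; pen F-6b named by ★routeR-w1 g9 07:35:40Z).  OBJECT: print's (125) straight step
`(L·Q₀X)(q, κ) = L·Σ_{r∈[0,L)ᵈ} L^{−(d+1)}·R(V(Γ_{q,q+r}))·(R_{0,q+r}X)([q+r, q+r+Le_κ])` (lit ✓`B7Prop3GeneralLinear.Q0cov`; the `LINE^{cov}` of
★routeR-w1's F-5a ✓`Prop7CombTrueStepSplit`) and its COVARIANT coarse difference across the `L`-bond `⟨q, q + Le_ν⟩` of the averaged background,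
`R(V̄(q,ν))·(L·Q₀X)(q + Le_ν, κ) − (L·Q₀X)(q, κ)`, `V̄ = bavg L V` (lit (42)).
* §1 ★`tsum_seg_eq_sum`, ★★`smul_Q0cov_eq_sum`: `L·Q₀X(q,κ) = Σ_{r,t<L} L⁻ᵈ • R(V(treeWord r ++ seg κ t from q))·X(q + r + t•e_κ, κ)`.
* §2 ★★`covGrad_smul_Q0cov_eq` — EXACT SPLIT: the covariant coarse difference = `Σ_{r,t} L⁻ᵈ • [ Σ_{s<L} R(V(p_{rt} ++ seg ν s)) (∇^V_ν X)(w + s•e_ν, κ)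
  + DEF_{rt} ]`, `p_{rt} = treeWord r ++ seg κ t`, `w = q + r + t•e_κ`, where the first sum is ✓`Prop7CornerCombLoopDefects.conjR_hol_append_seg_sub_eq_sum`
  (NO defect) and `DEF_{rt} = R(κ₀·V(seg ν L ++ p_{rt} from q))X(w′) − R(V(p_{rt} ++ seg ν L from q))X(w′)`, `w′ = w + Le_ν`, `κ₀ = exp X_c` of (42);
  ★`norm_DEF_le`: `‖DEF_{rt}‖ ≤ (24α + 8((d+2)L)²·a)·‖X(w′,κ)‖` (re-basing loop of length `≤ 2(d+2)L`, ✓`norm_conjR_hol_sub_conjR_hol_le`; `‖κ₀ − 1‖ ≤ 12α`,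
  ✓`Prop7CombTrueStepSplit.norm_eml_sub_one_le_of_loops`).
* §3 ★★★`sqrt_sum_normSq_covGrad_smul_Q0cov_le` — MINKOWSKI over a finite set `Zc` of coarse sites with `Zf ⊇` every `L•z + r + t•e_κ + s•e_ν`
  (`t < L`, `s ≤ L`):  `√Σ_{z∈Zc}‖∇^{V̄}_ν(L·Q₀X)(L•z,κ)‖² ≤ √(L⁴L⁻ᵈ)·√Σ_{w∈Zf}‖R(V(w,ν))X(w+e_ν,κ) − X(w,κ)‖² + (24α + 8((d+2)L)²a)·√(L²L⁻ᵈ)·√Σ_{w∈Zf}‖X(w,κ)‖²`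
  — the SHARP `√(L⁴L⁻ᵈ)` on the covariant gradient energy (column count `L²`, ✓`card_fiber2_le`), the plaquette∕loop size only on the MASS term
  (column count `L`, ✓`card_fiber_le`): the comb twin of ✓`Prop7CovLineGradL2.sqrt_sum_normSq_covGrad_line_le`, k-uniform when iterated along the
  background tower (ρ_g = `√(L⁴L⁻ᵈ)`, κ_j = `O(L^{(2−d)∕2}(α_j + L²a_j))` geometric from the top under RegPr — ✓`Prop7CovLineIterGrad.grad_recursion`).
`𝔸` any non-trivial C⋆-algebra; `V` unitary-valued; any `d`, `L ≥ 1`.  HONEST: one covariant estimate; nothing of `hMcomb` ∕ `hMcomb₂` ∕ (β) ∕ `hD` ∕ the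
crux 19200 is proved or claimed; rung R3 (YM₃ on T³), not d = 4, not infinite volume, not a mass gap, not Clay.
-/

noncomputable section

open scoped BigOperators
open Finset

namespace Summit.QuantumFields.YangMills.Theorems.Prop7CornerCombCovGradTransfer

open NormedSpace
open Literature.MathematicalPhysics.QuantumFieldTheory.Balaban1983to89
open B7Prop1Explicit (Site Letter e hol seg treeWord boxVec gammaWord Wcx Xavg bavg expUnit U1 disp l1 plaqWord hol_append disp_seg
  disp_treeWord length_treeWord length_seg l1_boxVec_le hol_mem)
open B7Prop2Explicit (unitaryUnits unitaryUnits_le_U1 hol_mem_of)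
open B7Eq78Linearization (conjR conjR_apply conjR_sub conjR_smul_real)
open B7Prop3GeneralRotated (tsum tstep norm_conjR_le conjR_mul_left)
open B7Prop3GeneralLinear (Q0cov)
open Summit.QuantumFields.YangMills.Theorems.Prop7CombTildTrueLin (expUnit_Xavg_mem_unitaryUnits)
open Summit.QuantumFields.YangMills.Theorems.Prop7CombTrueStepSplit (norm_eml_sub_one_le_of_loops)
open Summit.QuantumFields.YangMills.Theorems.Prop7CornerCombLoopDefects (norm_conjR_hol_sub_conjR_hol_le conjR_hol_append_seg_sub_eq_sum)
open Summit.QuantumFields.YangMills.Theorems.Prop7CornerCombFlatJensen (card_fiber_le)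
open Summit.QuantumFields.YangMills.Theorems.Prop7CornerCombFlatGradTransfer (card_fiber2_le)

variable {d : ℕ} {𝔸 : Type*} [CStarAlgebra 𝔸] [Nontrivial 𝔸]

/-! ## §1 `L·Q₀` as a weighted sum of transported bond values -/

omit [Nontrivial 𝔸] in
/-- ★ The transported sum along a forward segment: `(R_{0,p}X)([p, p + Le_κ]) = Σ_{t<L} R(V([p, p + te_κ]))·X(p + te_κ, κ)`.
[cite: Balaban1985Averaging, (115) p.34, (125) p.36] -/
theorem tsum_seg_eq_sum (V : Site d → Fin d → 𝔸ˣ) (X : Site d → Fin d → 𝔸) (p : Site d) (κ : Fin d) :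
    ∀ L : ℕ, tsum V X p (seg κ (L : ℤ)) = ∑ t ∈ Finset.range L, conjR (hol V p (seg κ (t : ℤ))) (X (p + (t : ℤ) • e κ) κ)
  | 0 => by simp
  | L + 1 => by
    rw [Finset.sum_range_succ, ← tsum_seg_eq_sum V X p κ L]
    have hseg : seg κ (((L + 1 : ℕ) : ℤ)) = seg κ (L : ℤ) ++ [(κ, true)] := by
      rw [B7Prop1Explicit.seg_natCast, B7Prop1Explicit.seg_natCast, List.replicate_succ']
    rw [hseg, B7Prop3GeneralRotated.tsum_append, disp_seg, B7Prop3GeneralRotated.tsum_cons, B7Prop3GeneralRotated.tsum_nil]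
    have h0 : conjR (B7Prop1Explicit.stepHol V (p + (L : ℤ) • e κ) (κ, true)) (0 : 𝔸) = 0 := by simp [conjR_apply]
    rw [h0, add_zero]
    simp [tstep]

omit [Nontrivial 𝔸] in
/-- ★★ **PRINT's STRAIGHT STEP, UNFOLDED**: `L·(Q₀X)(q, κ) = Σ_{r∈[0,L)ᵈ} Σ_{t<L} L⁻ᵈ • R(V(treeWord r ++ seg κ t from q))·X(q + r + t•e_κ, κ)` —
`Lᵈ·L` transported bond values of weight `L⁻ᵈ` (lit ✓`Q0cov`, (125)). [cite: Balaban1985Averaging, (125) p.36] -/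
theorem smul_Q0cov_eq_sum (L : ℕ) (hL : 1 ≤ L) (V : Site d → Fin d → 𝔸ˣ) (X : Site d → Fin d → 𝔸) (q : Site d) (κ : Fin d) :
    (L : ℝ) • Q0cov L V X q κ = ∑ r : Fin d → Fin L, ∑ t ∈ Finset.range L, (((L : ℝ) ^ d)⁻¹) •
      conjR (hol V q (treeWord (boxVec L r) ++ seg κ (t : ℤ))) (X (q + boxVec L r + (t : ℤ) • e κ) κ) := by
  have hL0 : (L : ℝ) ≠ 0 := by exact_mod_cast (show L ≠ 0 by omega)
  unfold Q0cov
  rw [Finset.smul_sum]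
  refine Finset.sum_congr rfl fun r _ => ?_
  rw [smul_smul, show (L : ℝ) * (((L : ℝ) ^ (d + 1))⁻¹) = ((L : ℝ) ^ d)⁻¹ by rw [pow_succ]; field_simp, tsum_seg_eq_sum,
    B7Prop3GeneralLinearSplit.conjR_sum, Finset.smul_sum]
  refine Finset.sum_congr rfl fun t _ => ?_
  rw [hol_append, disp_treeWord, conjR_mul_left]

/-! ## §2 The covariant coarse difference: exact split into transported covariant unit differences + re-basing defects -/

omit [Nontrivial 𝔸] in
/-- The displacement of `treeWord r ++ seg κ t` is `r + t•e_κ`. [folklore] -/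
theorem disp_treeWord_append_seg (L : ℕ) (r : Fin d → Fin L) (κ : Fin d) (t : ℕ) :
    disp (treeWord (boxVec L r) ++ seg κ (t : ℤ)) = boxVec L r + (t : ℤ) • e κ := by
  rw [B7Prop1Explicit.disp_append, disp_treeWord, disp_seg]

omit [Nontrivial 𝔸] in
/-- ★★ **EXACT SPLIT OF THE COVARIANT COARSE DIFFERENCE OF `L·Q₀`.**  Across the coarse bond `⟨q, q + Le_ν⟩` of the averaged background
`V̄ = bavg L V` ((42): `V̄(q,ν) = κ₀·V([q, q + Le_ν])`, `κ₀ = exp X_c`):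
`R(V̄(q,ν))·(L·Q₀X)(q + Le_ν, κ) − (L·Q₀X)(q, κ) = Σ_{r,t<L} L⁻ᵈ • [ Σ_{s<L} R(V(p ++ seg ν s)) (R(V(w+se_ν,ν)) X(w+(s+1)e_ν,κ) − X(w+se_ν,κ)) + DEF_{r,t} ]`,
`p = treeWord r ++ seg κ t` from `q`, `w = q + r + te_κ`, `DEF_{r,t} = R(κ₀·V(seg ν L ++ p))X(w + Le_ν,κ) − R(V(p ++ seg ν L))X(w + Le_ν,κ)` — the
first bracket is the EXACT telescoping ✓`conjR_hol_append_seg_sub_eq_sum` (no defect), the second the re-basing of the transport (a loop) and the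
`exp` correction. [cite: Balaban1985Averaging, (42) p.23, (125) p.36] [cite: Balaban1984PropagatorsI, (1.18)-(1.20) pp.19-20] -/
theorem covGrad_smul_Q0cov_eq (L : ℕ) (hL : 1 ≤ L) (V : Site d → Fin d → 𝔸ˣ) (X : Site d → Fin d → 𝔸) (q : Site d) (κ ν : Fin d) :
    conjR (bavg L V q ν) ((L : ℝ) • Q0cov L V X (q + (L : ℤ) • e ν) κ) - (L : ℝ) • Q0cov L V X q κ
      = ∑ r : Fin d → Fin L, ∑ t ∈ Finset.range L, (((L : ℝ) ^ d)⁻¹) •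
        ((∑ s ∈ Finset.range L, conjR (hol V q ((treeWord (boxVec L r) ++ seg κ (t : ℤ)) ++ seg ν (s : ℤ)))
            (conjR (V (q + boxVec L r + (t : ℤ) • e κ + (s : ℤ) • e ν) ν)
                (X (q + boxVec L r + (t : ℤ) • e κ + (s : ℤ) • e ν + e ν) κ)
              - X (q + boxVec L r + (t : ℤ) • e κ + (s : ℤ) • e ν) κ))
          + (conjR (expUnit (Xavg L V q ν) * hol V q (seg ν (L : ℤ) ++ (treeWord (boxVec L r) ++ seg κ (t : ℤ))))
                (X (q + boxVec L r + (t : ℤ) • e κ + (L : ℤ) • e ν) κ)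
              - conjR (hol V q ((treeWord (boxVec L r) ++ seg κ (t : ℤ)) ++ seg ν (L : ℤ)))
                (X (q + boxVec L r + (t : ℤ) • e κ + (L : ℤ) • e ν) κ))) := by
  rw [smul_Q0cov_eq_sum L hL V X (q + (L : ℤ) • e ν) κ, smul_Q0cov_eq_sum L hL V X q κ,
    B7Prop3GeneralLinearSplit.conjR_sum, ← Finset.sum_sub_distrib]
  refine Finset.sum_congr rfl fun r _ => ?_
  rw [B7Prop3GeneralLinearSplit.conjR_sum, ← Finset.sum_sub_distrib]
  refine Finset.sum_congr rfl fun t _ => ?_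
  rw [conjR_smul_real, ← smul_sub]
  congr 1
  -- the exact telescoping of the re-based transport
  have htel := conjR_hol_append_seg_sub_eq_sum V q (treeWord (boxVec L r) ++ seg κ (t : ℤ)) ν (fun y => X y κ) L
  simp only [disp_treeWord_append_seg, ← add_assoc] at htel
  -- `R(V̄(q,ν))·R(V(p from q′)) = R(κ₀·V(seg ν L ++ p from q))` and the site `q′ + r + te_κ = w + Le_ν`
  have hconj : conjR (bavg L V q ν) (conjR (hol V (q + (L : ℤ) • e ν) (treeWord (boxVec L r) ++ seg κ (t : ℤ)))
        (X (q + (L : ℤ) • e ν + boxVec L r + (t : ℤ) • e κ) κ))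
      = conjR (expUnit (Xavg L V q ν) * hol V q (seg ν (L : ℤ) ++ (treeWord (boxVec L r) ++ seg κ (t : ℤ))))
          (X (q + boxVec L r + (t : ℤ) • e κ + (L : ℤ) • e ν) κ) := by
    rw [← conjR_mul_left]
    conv_rhs => rw [hol_append, disp_seg]
    have hsite : q + (L : ℤ) • e ν + boxVec L r + (t : ℤ) • e κ = q + boxVec L r + (t : ℤ) • e κ + (L : ℤ) • e ν := by abel
    rw [hsite]
    congr 1
    rw [← mul_assoc]
    rfl
  rw [hconj, ← htel]
  abel

/-- ★ **THE DEFECT IS A MASS TERM**: `‖DEF_{r,t}‖ ≤ (24α + 8((d+2)L)²·a)·‖X(w + Le_ν, κ)‖` — the re-basing loop has length `≤ 2(d+2)L`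
(✓`norm_conjR_hol_sub_conjR_hol_le`), the `exp` correction `‖κ₀ − 1‖ ≤ 12α` (✓`Prop7CombTrueStepSplit.norm_eml_sub_one_le_of_loops`) acts by
conjugation (lit ✓`B8CurlGradHolonomy.norm_conj_sub_le`). [cite: Balaban1985Averaging, (44)-(47) pp.24-25, Prop. 1 p.22] -/
theorem norm_def_le (L : ℕ) (V : Site d → Fin d → 𝔸ˣ) (hV : ∀ x μ, V x μ ∈ unitaryUnits 𝔸)
    {a : ℝ} (ha : 0 ≤ a) (hplaq : ∀ (x : Site d) (κ' μ : Fin d), κ' ≠ μ → ‖((hol V x (plaqWord κ' μ) : 𝔸ˣ) : 𝔸) - 1‖ ≤ a)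
    {α : ℝ} (hα0 : 0 ≤ α) (hα24 : α ≤ 1 / 24) (q : Site d) (ν : Fin d)
    (hW : ∀ r : Fin d → Fin L, ‖((Wcx L V q ν (boxVec L r) : 𝔸ˣ) : 𝔸) - 1‖ ≤ α)
    (X : Site d → Fin d → 𝔸) (κ : Fin d) (r : Fin d → Fin L) (t : ℕ) (ht : t < L) :
    ‖conjR (expUnit (Xavg L V q ν) * hol V q (seg ν (L : ℤ) ++ (treeWord (boxVec L r) ++ seg κ (t : ℤ))))
          (X (q + boxVec L r + (t : ℤ) • e κ + (L : ℤ) • e ν) κ)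
        - conjR (hol V q ((treeWord (boxVec L r) ++ seg κ (t : ℤ)) ++ seg ν (L : ℤ)))
          (X (q + boxVec L r + (t : ℤ) • e κ + (L : ℤ) • e ν) κ)‖
      ≤ (24 * α + 8 * (((d : ℝ) + 2) * L) ^ 2 * a) * ‖X (q + boxVec L r + (t : ℤ) • e κ + (L : ℤ) • e ν) κ‖ := by
  have hV' : ∀ x μ, V x μ ∈ U1 𝔸 := fun x μ => unitaryUnits_le_U1 (hV x μ)
  set Y : 𝔸 := X (q + boxVec L r + (t : ℤ) • e κ + (L : ℤ) • e ν) κ with hY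
  set p : List (Letter d) := treeWord (boxVec L r) ++ seg κ (t : ℤ) with hp
  set P₁ : 𝔸ˣ := hol V q (seg ν (L : ℤ) ++ p) with hP₁
  set P₂ : 𝔸ˣ := hol V q (p ++ seg ν (L : ℤ)) with hP₂
  set κ₀ : 𝔸ˣ := expUnit (Xavg L V q ν) with hκ₀
  have hP₁m : P₁ ∈ U1 𝔸 := hol_mem hV' _ _
  -- the `exp` correction
  have hκ₀m : κ₀ ∈ U1 𝔸 :=
    unitaryUnits_le_U1 (expUnit_Xavg_mem_unitaryUnits L hV q ν fun r' => (hW r').trans (hα24.trans (by norm_num)))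
  have hκ₀1 : ‖(κ₀ : 𝔸) - 1‖ ≤ 12 * α := norm_eml_sub_one_le_of_loops L V q ν hW hα24 hα0
  have h1 : ‖conjR (κ₀ * P₁) Y - conjR P₁ Y‖ ≤ 24 * α * ‖Y‖ := by
    rw [conjR_mul_left, conjR_apply κ₀]
    calc _ ≤ 2 * ‖(κ₀ : 𝔸) - 1‖ * ‖conjR P₁ Y‖ := B8CurlGradHolonomy.norm_conj_sub_le κ₀ _ hκ₀m.2
      _ ≤ 2 * (12 * α) * ‖Y‖ := by gcongr; exact norm_conjR_le hP₁m _
      _ = 24 * α * ‖Y‖ := by ring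
  -- the re-basing loop
  have hlen : ((seg ν (L : ℤ) ++ p).length + (p ++ seg ν (L : ℤ)).length : ℕ) ≤ 2 * ((d + 2) * L) := by
    have hp' : p.length ≤ d * L + L := by
      rw [hp, List.length_append, length_treeWord, length_seg, Int.natAbs_natCast]
      have := l1_boxVec_le L r
      omega
    simp only [List.length_append, length_seg, Int.natAbs_natCast]
    nlinarith
  have hdisp : disp (seg ν (L : ℤ) ++ p) = disp (p ++ seg ν (L : ℤ)) := by
    simp only [hp, B7Prop1Explicit.disp_append]; abel
  have h2 := norm_conjR_hol_sub_conjR_hol_le V hV' ha hplaq q (seg ν (L : ℤ) ++ p) (p ++ seg ν (L : ℤ)) hdisp Y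
  have h2' : ‖conjR P₁ Y - conjR P₂ Y‖ ≤ 8 * (((d : ℝ) + 2) * L) ^ 2 * a * ‖Y‖ := by
    refine h2.trans (mul_le_mul_of_nonneg_right ?_ (norm_nonneg _))
    have hℓ : (((seg ν (L : ℤ) ++ p).length + (p ++ seg ν (L : ℤ)).length : ℕ) : ℝ) ≤ 2 * (((d : ℝ) + 2) * L) := by
      exact_mod_cast hlen
    have hℓ0 : (0 : ℝ) ≤ (((seg ν (L : ℤ) ++ p).length + (p ++ seg ν (L : ℤ)).length : ℕ) : ℝ) := Nat.cast_nonneg _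
    set ℓ : ℝ := (((seg ν (L : ℤ) ++ p).length + (p ++ seg ν (L : ℤ)).length : ℕ) : ℝ) with hℓdef
    have hℓ2 : ℓ * ℓ ≤ (2 * (((d : ℝ) + 2) * L)) * (2 * (((d : ℝ) + 2) * L)) := mul_le_mul hℓ hℓ hℓ0 (hℓ0.trans hℓ)
    have h3 : ℓ * (ℓ * a) ≤ (2 * (((d : ℝ) + 2) * L)) * (2 * (((d : ℝ) + 2) * L)) * a := by
      rw [← mul_assoc]; exact mul_le_mul_of_nonneg_right hℓ2 ha
    nlinarith [h3]
  calc _ = ‖(conjR (κ₀ * P₁) Y - conjR P₁ Y) + (conjR P₁ Y - conjR P₂ Y)‖ := by rw [sub_add_sub_cancel]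
    _ ≤ ‖conjR (κ₀ * P₁) Y - conjR P₁ Y‖ + ‖conjR P₁ Y - conjR P₂ Y‖ := norm_add_le _ _
    _ ≤ 24 * α * ‖Y‖ + 8 * (((d : ℝ) + 2) * L) ^ 2 * a * ‖Y‖ := add_le_add h1 h2'
    _ = (24 * α + 8 * (((d : ℝ) + 2) * L) ^ 2 * a) * ‖Y‖ := by ring

/-! ## §3 Minkowski: the covariant gradient transfer in `ℓ²` over any finite set of coarse sites -/

omit [Nontrivial 𝔸] in
/-- Minkowski for two nonnegative families (a private copy of ✓`Prop7CovIterLambdaBound.sqrt_sum_sq_add_le`, kept private to keep the import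
closure of the (II) lane small). [folklore] -/
private theorem sqrt_sum_sq_add_le' {ι : Type*} (s : Finset ι) (a b : ι → ℝ) (ha : ∀ i ∈ s, 0 ≤ a i) (hb : ∀ i ∈ s, 0 ≤ b i) :
    Real.sqrt (∑ i ∈ s, (a i + b i) ^ 2) ≤ Real.sqrt (∑ i ∈ s, a i ^ 2) + Real.sqrt (∑ i ∈ s, b i ^ 2) := by
  set A : ℝ := ∑ i ∈ s, a i ^ 2 with hA
  set B : ℝ := ∑ i ∈ s, b i ^ 2 with hB
  have hA0 : 0 ≤ A := Finset.sum_nonneg fun i _ => sq_nonneg _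
  have hB0 : 0 ≤ B := Finset.sum_nonneg fun i _ => sq_nonneg _
  have hcs : (∑ i ∈ s, a i * b i) ^ 2 ≤ A * B := Finset.sum_mul_sq_le_sq_mul_sq s a b
  have hab0 : 0 ≤ ∑ i ∈ s, a i * b i := Finset.sum_nonneg fun i hi => mul_nonneg (ha i hi) (hb i hi)
  have hcs' : ∑ i ∈ s, a i * b i ≤ Real.sqrt A * Real.sqrt B := by
    rw [← Real.sqrt_mul hA0, ← Real.sqrt_sq hab0]
    exact Real.sqrt_le_sqrt hcs
  have hexp : ∑ i ∈ s, (a i + b i) ^ 2 = A + 2 * ∑ i ∈ s, a i * b i + B := by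
    rw [hA, hB, Finset.mul_sum, ← Finset.sum_add_distrib, ← Finset.sum_add_distrib]
    exact Finset.sum_congr rfl fun i _ => by ring
  have hrhs0 : 0 ≤ Real.sqrt A + Real.sqrt B := add_nonneg (Real.sqrt_nonneg _) (Real.sqrt_nonneg _)
  rw [← Real.sqrt_sq hrhs0]
  refine Real.sqrt_le_sqrt ?_
  rw [hexp, add_sq, Real.sq_sqrt hA0, Real.sq_sqrt hB0]
  nlinarith [hcs']

omit [Nontrivial 𝔸] in
/-- Scalar Jensen with a constant weight: `(Σ_{p∈I} c·g p)² ≤ (#I·c²)·Σ_{p∈I} (g p)²`. [folklore] -/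
private theorem sq_sum_const_mul_le {β : Type*} (I : Finset β) (c : ℝ) (g : β → ℝ) :
    (∑ p ∈ I, c * g p) ^ 2 ≤ (#I * c ^ 2) * ∑ p ∈ I, g p ^ 2 := by
  calc (∑ p ∈ I, c * g p) ^ 2 ≤ #I * ∑ p ∈ I, (c * g p) ^ 2 := sq_sum_le_card_mul_sum_sq
    _ = (#I * c ^ 2) * ∑ p ∈ I, g p ^ 2 := by simp only [mul_pow, ← Finset.mul_sum]; ring

omit [Nontrivial 𝔸] in
/-- Regrouping a sum over a finite index set by the image of a map with bounded fibres. [folklore] -/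
private theorem sum_comp_le_mul {β : Type*} (P : Finset β) (π : β → Site d) (g : Site d → ℝ) (Zf : Finset (Site d))
    (hmaps : ∀ p ∈ P, π p ∈ Zf) (hg : ∀ w ∈ Zf, 0 ≤ g w) (m : ℕ) (hmult : ∀ w ∈ Zf, #{p ∈ P | π p = w} ≤ m) :
    ∑ p ∈ P, g (π p) ≤ m * ∑ w ∈ Zf, g w := by
  classical
  rw [Finset.sum_comp (s := P) (f := g) (g := π)]
  have hsub : P.image π ⊆ Zf := by
    intro w hw
    obtain ⟨p, hp, rfl⟩ := Finset.mem_image.mp hw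
    exact hmaps p hp
  calc ∑ w ∈ P.image π, (#{p ∈ P | π p = w}) • g w ≤ ∑ w ∈ P.image π, (m : ℝ) * g w := by
        refine Finset.sum_le_sum fun w hw => ?_
        rw [nsmul_eq_mul]
        exact mul_le_mul_of_nonneg_right (by exact_mod_cast hmult w (hsub hw)) (hg w (hsub hw))
    _ ≤ ∑ w ∈ Zf, (m : ℝ) * g w :=
        Finset.sum_le_sum_of_subset_of_nonneg hsub fun w hw _ => mul_nonneg (Nat.cast_nonneg _) (hg w hw)
    _ = m * ∑ w ∈ Zf, g w := by rw [Finset.mul_sum]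

/-- ★★★ **THE COVARIANT GRADIENT TRANSFER OF PRINT's STRAIGHT STEP, IN `ℓ²` (MINKOWSKI FORM).**  `V` unitary-valued on `ℤᵈ` with every plaquette
holonomy within `a` of `1` and every block loop `V(Γ_{c,x})V(c)⁻¹` within `α ≤ 1∕24` of `1`; `Zc` a finite set of coarse sites, `Zf ∋ L•z + r + t•e_κ + s•e_ν`
for all `z ∈ Zc`, `r ∈ [0,L)ᵈ`, `t < L`, `s ≤ L`.  Then
`√Σ_{z∈Zc} ‖R(V̄(L•z,ν))·(L·Q₀X)(L•z + Le_ν, κ) − (L·Q₀X)(L•z, κ)‖² ≤ √(L⁴L⁻ᵈ)·√Σ_{w∈Zf}‖R(V(w,ν))X(w+e_ν,κ) − X(w,κ)‖²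
  + (24α + 8((d+2)L)²a)·√(L²L⁻ᵈ)·√Σ_{w∈Zf}‖X(w,κ)‖²` — the SHARP `√(L⁴L⁻ᵈ)` on the covariant gradient energy (column count `L²`), the loop∕`exp`
sizes only on the MASS term (column count `L`): the comb twin of ✓`Prop7CovLineGradL2.sqrt_sum_normSq_covGrad_line_le` (MASTER §1 row 6), iterable
along the background tower by ✓`Prop7CovLineIterGrad.grad_recursion` with `ρ_g = √(L⁴L⁻ᵈ)`, `κ_j = (24α_j + 8((d+2)L)²a_j)·√(L²L⁻ᵈ)` geometric from the top
under RegPr — k-UNIFORM.  «(O2) groundwork — not consumed by any displayed row before the freeze lifts.»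
[cite: Balaban1984PropagatorsI, (1.18)-(1.20) pp.19-20] [cite: Balaban1985Averaging, (42) p.23, (125) p.36, (44)-(47) pp.24-25] -/
theorem sqrt_sum_normSq_covGrad_smul_Q0cov_le (L : ℕ) (hL : 1 ≤ L) (V : Site d → Fin d → 𝔸ˣ) (hV : ∀ x μ, V x μ ∈ unitaryUnits 𝔸)
    {a : ℝ} (ha : 0 ≤ a) (hplaq : ∀ (x : Site d) (κ' μ : Fin d), κ' ≠ μ → ‖((hol V x (plaqWord κ' μ) : 𝔸ˣ) : 𝔸) - 1‖ ≤ a)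
    {α : ℝ} (hα0 : 0 ≤ α) (hα24 : α ≤ 1 / 24)
    (hW : ∀ (q : Site d) (κ' : Fin d) (r : Fin d → Fin L), ‖((Wcx L V q κ' (boxVec L r) : 𝔸ˣ) : 𝔸) - 1‖ ≤ α)
    (X : Site d → Fin d → 𝔸) (κ ν : Fin d) (Zc Zf : Finset (Site d))
    (hZf : ∀ z ∈ Zc, ∀ (r : Fin d → Fin L) (t s : ℕ), t < L → s ≤ L →
      (L : ℤ) • z + boxVec L r + (t : ℤ) • e κ + (s : ℤ) • e ν ∈ Zf) :
    Real.sqrt (∑ z ∈ Zc, ‖conjR (bavg L V ((L : ℤ) • z) ν) ((L : ℝ) • Q0cov L V X ((L : ℤ) • z + (L : ℤ) • e ν) κ)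
        - (L : ℝ) • Q0cov L V X ((L : ℤ) • z) κ‖ ^ 2)
      ≤ Real.sqrt ((L : ℝ) ^ 4 * ((L : ℝ) ^ d)⁻¹)
          * Real.sqrt (∑ w ∈ Zf, ‖conjR (V w ν) (X (w + e ν) κ) - X w κ‖ ^ 2)
        + (24 * α + 8 * (((d : ℝ) + 2) * L) ^ 2 * a) * Real.sqrt ((L : ℝ) ^ 2 * ((L : ℝ) ^ d)⁻¹)
          * Real.sqrt (∑ w ∈ Zf, ‖X w κ‖ ^ 2) := by
  classical
  have hV' : ∀ x μ, V x μ ∈ U1 𝔸 := fun x μ => unitaryUnits_le_U1 (hV x μ)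
  set c : ℝ := ((L : ℝ) ^ d)⁻¹ with hc
  have hc0 : 0 ≤ c := by positivity
  set K : ℝ := 24 * α + 8 * (((d : ℝ) + 2) * L) ^ 2 * a with hK
  have hK0 : 0 ≤ K := by positivity
  set G : Site d → ℝ := fun w => ‖conjR (V w ν) (X (w + e ν) κ) - X w κ‖ with hG
  set M : Site d → ℝ := fun w => ‖X w κ‖ with hM
  -- index sets and site maps
  set I : Finset ((Fin d → Fin L) × (ℕ × ℕ)) := (Finset.univ : Finset (Fin d → Fin L)) ×ˢ (Finset.range L ×ˢ Finset.range L) with hI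
  set I' : Finset ((Fin d → Fin L) × ℕ) := (Finset.univ : Finset (Fin d → Fin L)) ×ˢ Finset.range L with hI'
  set π : Site d → (Fin d → Fin L) × (ℕ × ℕ) → Site d :=
    fun z p => (L : ℤ) • z + boxVec L p.1 + (p.2.1 : ℤ) • e κ + (p.2.2 : ℤ) • e ν with hπ
  set π' : Site d → (Fin d → Fin L) × ℕ → Site d :=
    fun z p => (L : ℤ) • z + boxVec L p.1 + (p.2 : ℤ) • e κ + (L : ℤ) • e ν with hπ'
  set A : Site d → ℝ := fun z => ∑ p ∈ I, c * G (π z p) with hA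
  set B : Site d → ℝ := fun z => ∑ p ∈ I', (c * K) * M (π' z p) with hB
  have hA0 : ∀ z, 0 ≤ A z := fun z => Finset.sum_nonneg fun p _ => mul_nonneg hc0 (norm_nonneg _)
  have hB0 : ∀ z, 0 ≤ B z := fun z => Finset.sum_nonneg fun p _ => mul_nonneg (mul_nonneg hc0 hK0) (norm_nonneg _)
  -- STEP 1: the pointwise bound `‖D z‖ ≤ A z + B z`
  have hpt : ∀ z ∈ Zc, ‖conjR (bavg L V ((L : ℤ) • z) ν) ((L : ℝ) • Q0cov L V X ((L : ℤ) • z + (L : ℤ) • e ν) κ)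
      - (L : ℝ) • Q0cov L V X ((L : ℤ) • z) κ‖ ≤ A z + B z := by
    intro z _
    simp only [hA, hB, hI, hI', hπ, hπ', hG, hM, Finset.sum_product]
    rw [covGrad_smul_Q0cov_eq L hL V X ((L : ℤ) • z) κ ν, ← Finset.sum_add_distrib]
    refine (norm_sum_le _ _).trans (Finset.sum_le_sum fun r _ => ?_)
    rw [← Finset.sum_add_distrib]
    refine (norm_sum_le _ _).trans (Finset.sum_le_sum fun t ht => ?_)
    have ht' : t < L := Finset.mem_range.mp ht
    rw [norm_smul, Real.norm_of_nonneg hc0, ← Finset.mul_sum, mul_assoc c K, ← mul_add]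
    refine mul_le_mul_of_nonneg_left ((norm_add_le _ _).trans (add_le_add ?_ ?_)) hc0
    · refine (norm_sum_le _ _).trans (Finset.sum_le_sum fun s _ => ?_)
      exact norm_conjR_le (hol_mem hV' _ _) _
    · exact norm_def_le L V hV ha hplaq hα0 hα24 ((L : ℤ) • z) ν (hW _ ν) X κ r t ht'
  -- STEP 2: Minkowski
  have h2 : Real.sqrt (∑ z ∈ Zc, ‖conjR (bavg L V ((L : ℤ) • z) ν) ((L : ℝ) • Q0cov L V X ((L : ℤ) • z + (L : ℤ) • e ν) κ)
        - (L : ℝ) • Q0cov L V X ((L : ℤ) • z) κ‖ ^ 2)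
      ≤ Real.sqrt (∑ z ∈ Zc, A z ^ 2) + Real.sqrt (∑ z ∈ Zc, B z ^ 2) := by
    refine (Real.sqrt_le_sqrt (Finset.sum_le_sum fun z hz => ?_)).trans (sqrt_sum_sq_add_le' Zc A B (fun z _ => hA0 z) fun z _ => hB0 z)
    exact pow_le_pow_left₀ (norm_nonneg _) (hpt z hz) 2
  -- STEP 3: the gradient part — Jensen (`L^{d+2}` terms of weight `c`) and the column count `L²`
  have hcardI : (#I : ℝ) = (L : ℝ) ^ d * L * L := by
    rw [hI, Finset.card_product, Finset.card_product, Finset.card_univ, Fintype.card_fun, Fintype.card_fin, Fintype.card_fin, Finset.card_range]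
    push_cast; ring
  have hcardI' : (#I' : ℝ) = (L : ℝ) ^ d * L := by
    rw [hI', Finset.card_product, Finset.card_univ, Fintype.card_fun, Fintype.card_fin, Fintype.card_fin, Finset.card_range]
    push_cast; ring
  have hLd : (L : ℝ) ^ d * c = 1 := by
    rw [hc]; exact mul_inv_cancel₀ (pow_ne_zero _ (by exact_mod_cast (show L ≠ 0 by omega)))
  have h3 : ∑ z ∈ Zc, A z ^ 2 ≤ ((L : ℝ) ^ 4 * c) * ∑ w ∈ Zf, G w ^ 2 := by
    have hstep : ∀ z ∈ Zc, A z ^ 2 ≤ ((L : ℝ) ^ 2 * c) * ∑ p ∈ I, G (π z p) ^ 2 := by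
      intro z _
      refine (sq_sum_const_mul_le I c fun p => G (π z p)).trans (le_of_eq ?_)
      rw [hcardI]; congr 1
      calc (L : ℝ) ^ d * L * L * c ^ 2 = ((L : ℝ) ^ d * c) * ((L : ℝ) ^ 2 * c) := by ring
        _ = (L : ℝ) ^ 2 * c := by rw [hLd, one_mul]
    calc ∑ z ∈ Zc, A z ^ 2 ≤ ∑ z ∈ Zc, ((L : ℝ) ^ 2 * c) * ∑ p ∈ I, G (π z p) ^ 2 := Finset.sum_le_sum hstep
      _ = ((L : ℝ) ^ 2 * c) * ∑ zp ∈ Zc ×ˢ I, G (π zp.1 zp.2) ^ 2 := by rw [← Finset.mul_sum, Finset.sum_product]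
      _ ≤ ((L : ℝ) ^ 2 * c) * ((L ^ 2 : ℕ) * ∑ w ∈ Zf, G w ^ 2) := by
          refine mul_le_mul_of_nonneg_left ?_ (by positivity)
          refine sum_comp_le_mul (Zc ×ˢ I) (fun zp => π zp.1 zp.2) (fun w => G w ^ 2) Zf (fun zp hzp => ?_)
            (fun w _ => sq_nonneg _) (L ^ 2) (fun w _ => ?_)
          · rw [Finset.mem_product, hI, Finset.mem_product, Finset.mem_product] at hzp
            exact hZf zp.1 hzp.1 zp.2.1 zp.2.2.1 zp.2.2.2 (Finset.mem_range.mp hzp.2.2.1) (Finset.mem_range.mp hzp.2.2.2).le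
          · refine card_fiber2_le L hL κ ν (Zc ×ˢ I) (fun zp hzp => ?_) w
            rw [Finset.mem_product, hI, Finset.mem_product, Finset.mem_product] at hzp
            exact ⟨Finset.mem_range.mp hzp.2.2.1, Finset.mem_range.mp hzp.2.2.2⟩
      _ = ((L : ℝ) ^ 4 * c) * ∑ w ∈ Zf, G w ^ 2 := by push_cast; ring
  -- STEP 4: the mass part — Jensen (`L^{d+1}` terms of weight `c·K`) and the column count `L`
  have h4 : ∑ z ∈ Zc, B z ^ 2 ≤ (K ^ 2 * ((L : ℝ) ^ 2 * c)) * ∑ w ∈ Zf, M w ^ 2 := by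
    have hstep : ∀ z ∈ Zc, B z ^ 2 ≤ ((L : ℝ) * c * K ^ 2) * ∑ p ∈ I', M (π' z p) ^ 2 := by
      intro z _
      refine (sq_sum_const_mul_le I' (c * K) fun p => M (π' z p)).trans (le_of_eq ?_)
      rw [hcardI']; congr 1
      calc (L : ℝ) ^ d * L * (c * K) ^ 2 = ((L : ℝ) ^ d * c) * (L * c * K ^ 2) := by ring
        _ = (L : ℝ) * c * K ^ 2 := by rw [hLd, one_mul]
    calc ∑ z ∈ Zc, B z ^ 2 ≤ ∑ z ∈ Zc, ((L : ℝ) * c * K ^ 2) * ∑ p ∈ I', M (π' z p) ^ 2 := Finset.sum_le_sum hstep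
      _ = ((L : ℝ) * c * K ^ 2) * ∑ zp ∈ Zc ×ˢ I', M (π' zp.1 zp.2) ^ 2 := by rw [← Finset.mul_sum, Finset.sum_product]
      _ ≤ ((L : ℝ) * c * K ^ 2) * ((L : ℕ) * ∑ w ∈ Zf, M w ^ 2) := by
          refine mul_le_mul_of_nonneg_left ?_ (by positivity)
          refine sum_comp_le_mul (Zc ×ˢ I') (fun zp => π' zp.1 zp.2) (fun w => M w ^ 2) Zf (fun zp hzp => ?_)
            (fun w _ => sq_nonneg _) L (fun w _ => ?_)
          · rw [Finset.mem_product, hI', Finset.mem_product] at hzp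
            exact hZf zp.1 hzp.1 zp.2.1 zp.2.2 L (Finset.mem_range.mp hzp.2.2) le_rfl
          · -- shift the fibre by `−L•e_ν` and use ✓`card_fiber_le`
            have hfib : #{zp ∈ Zc ×ˢ I' | π' zp.1 zp.2 = w}
                = #{zp ∈ Zc ×ˢ I' | (L : ℤ) • zp.1 + boxVec L zp.2.1 + (zp.2.2 : ℤ) • e κ = w - (L : ℤ) • e ν} := by
              congr 1
              refine Finset.filter_congr fun zp _ => ?_
              simp only [hπ']
              constructor
              · intro h; rw [← h]; abel
              · intro h; rw [h]; abel
            rw [hfib]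
            refine card_fiber_le L hL κ (Zc ×ˢ I') (fun zp hzp => ?_) (w - (L : ℤ) • e ν)
            rw [Finset.mem_product, hI', Finset.mem_product] at hzp
            exact Finset.mem_range.mp hzp.2.2
      _ = (K ^ 2 * ((L : ℝ) ^ 2 * c)) * ∑ w ∈ Zf, M w ^ 2 := by ring
  -- ASSEMBLE
  have hG2 : 0 ≤ ∑ w ∈ Zf, G w ^ 2 := Finset.sum_nonneg fun _ _ => sq_nonneg _
  have hM2 : 0 ≤ ∑ w ∈ Zf, M w ^ 2 := Finset.sum_nonneg fun _ _ => sq_nonneg _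
  have h3' : Real.sqrt (∑ z ∈ Zc, A z ^ 2) ≤ Real.sqrt ((L : ℝ) ^ 4 * c) * Real.sqrt (∑ w ∈ Zf, G w ^ 2) := by
    rw [← Real.sqrt_mul (by positivity)]
    exact Real.sqrt_le_sqrt h3
  have h4' : Real.sqrt (∑ z ∈ Zc, B z ^ 2) ≤ K * Real.sqrt ((L : ℝ) ^ 2 * c) * Real.sqrt (∑ w ∈ Zf, M w ^ 2) := by
    have e1 : Real.sqrt (K ^ 2 * ((L : ℝ) ^ 2 * c)) = K * Real.sqrt ((L : ℝ) ^ 2 * c) := by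
      rw [Real.sqrt_mul (sq_nonneg K), Real.sqrt_sq hK0]
    have e2 : Real.sqrt ((K ^ 2 * ((L : ℝ) ^ 2 * c)) * ∑ w ∈ Zf, M w ^ 2)
        = Real.sqrt (K ^ 2 * ((L : ℝ) ^ 2 * c)) * Real.sqrt (∑ w ∈ Zf, M w ^ 2) := Real.sqrt_mul (by positivity) _
    rw [← e1, ← e2]
    exact Real.sqrt_le_sqrt h4
  exact h2.trans (add_le_add h3' h4')

end Summit.QuantumFields.YangMills.Theorems.Prop7CornerCombCovGradTransfer

end
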